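import Literature.Analysis.FluidPDE.KNSSOseenMildDecayTools
import Literature.Analysis.FluidPDE.OseenHeatKernelBridge
import Literature.Analysis.FluidPDE.NSBoundedMildSmoothing
import Literature.Analysis.FluidPDE.NSBoundedMildOseenRestart
import Literature.Analysis.FluidPDE.ClassicalBoundedWeak
import Literature.Analysis.FluidPDE.OseenDuhamelLimits
import Literature.Analysis.FluidPDE.AncientMildWeakStar
import Literature.Analysis.FluidPDE.KNSSWindowLipschitz
import HarnessLib

/-!
# KNSS 2009, Theorem 6.1, mildness clause, from Lemma 3.1: bounded classical solutions with
# horizontal decay satisfy the Oseen integral equation (proved reduction)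

Analysis/FluidPDE proof file on the discharge path of the named fact
`Literature.Analysis.FluidPDE.KNSS2009_oseenMild_of_cylRadius_decay` (`KNSSOseenMildDecay.lean`;
Koch–Nadirashvili–Seregin–Šverák, Acta Math. 203 (2009) = arXiv:0709.3599, Theorem 6.1: "Moreover,
`u` is a mild solution", proved on p. 12: "we inspect the decomposition of `u` constructed in
Lemma 3.1 with `f_k = −u_k u` … under the assumption (6.4), all the terms in the decomposition
`u = v + w + b` will again satisfy (6.4). It follows easily that `b` must vanish and therefore `u`
is a mild solution"). It proves

* `KNSS2009_oseenMild_of_cylRadius_decay_of_weak_driftMild :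
    KNSS2009_weak_driftMild → (the statement of KNSS2009_oseenMild_of_cylRadius_decay)`,

(the window form is proved for BOUNDED WEAK solutions continuous on the open slab,
`oseenMild_of_cylRadius_decay_window_of_boundedWeak`, of which the classical window form
`oseenMild_of_cylRadius_decay_window` is a corollary),

i.e. the mildness clause from KNSS's Lemma 3.1 in drift-mild form (`KNSS2009_weak_driftMild`,
`KNSSRegularityDecomposition.lean`, whose own discharge is the object of `KNSSLemma31*.lean`), the
conclusion being written out so that this file does not depend on the facts file. The printed
"easily" is carried out as follows, for a classical solution `(u, p)` (`ν = 1`) on `ℝ³ × (0, T)`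
bounded by `L` with `cylRadius (x − c)‖u(t, x)‖ ≤ D`:

1. `u` is a bounded weak solution (`IsClassicalNSSolutionOn.isBoundedWeakNSSolutionOn`), so
   Lemma 3.1 gives `u(t) = U(t) + b(t)` a.e. in `x` for a.e. `t` ("good" times, a dense set), with
   `U(t) = e^{(t−s)Δ}U(s) − ∫ₛᵗ e^{(t−σ)Δ}P∇·(u ⊗ u) dσ` for all `0 < s < t < T` and all `x`;
2. for good `s < t` and **every** `x` (both sides are continuous):
   `U(t, x) = e^{(t−s)Δ}u(s)(x) − b(s) − B¹_s(u,u)(t)(x)` — the drift-Duhamel term only sees the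
   a.e. class of `U + b = u` (`driftDuhamel_congr_ae`) and is the tree's `oseenDuhamel`
   (`driftDuhamel_zero_eq_oseenDuhamel`, `OseenHeatKernelBridge.lean`);
3. **the decay kills the drift**: `b(t) − b(s) = u(t, x) − e^{(t−s)Δ}u(s)(x) + B¹_s(u,u)(t)(x)` for
   every `x`, and along the points `c + n e₁` all three terms tend to `0` — `u` by (6.4), the
   caloric and Duhamel terms by dominated convergence of the horizontal translates
   (`tendsto_heatExtension_of_tendsto_of_bound`, `tendsto_oseenDuhamel_of_tendsto_of_bound`, with
   the covariances `heatExtension (g(· + a)) = (e^{σΔ}g)(· + a)`, `oseenDuhamel_comp_add_right`);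
   hence `b(t) = b(s)` and the Oseen identity holds between good times, everywhere in `x`;
4. from a good `s₀` to **every** later time by density and the time continuity of both sides
   (`continuousOn_oseenDuhamel_time`, `continuousOn_heatExtension_time`);
5. between **arbitrary** `0 < s < t < T` by the restart property of the integral equation
   (`restart_of_oseenMild_restart` with `oseenMild_restart_holds`) from a good `s₀ < s`, a.e. and
   then everywhere by continuity; arbitrary windows `(a, b)` by time translation.

## References

* G. Koch, N. Nadirashvili, G. Seregin, V. Šverák, *Liouville theorems for the Navier–Stokes
  equations and applications*, Acta Math. 203 (2009) 83–105 = arXiv:0709.3599 (arXiv pages):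
  Thm. 6.1 (p. 11) and its proof, last paragraph (p. 12); Lemma 3.1, Remark 3.1 (p. 7); §4 (i),
  (4.3), Remark 4.1 (p. 8). [KochNadirashviliSereginSverak2009]
-/

noncomputable section

open MeasureTheory Set Function Filter TopologicalSpace Metric
open _root_.Topology
open scoped RealInnerProductSpace NNReal ENNReal

namespace Literature.Analysis.FluidPDE

/-! ### Horizontal translates of a horizontally decaying field tend to zero -/

section Decay

variable {F : Type*} [NormedAddCommGroup F]

/-- The axis points `n e₁` have cylindrical radius `n`. [folklore] -/
theorem cylRadius_natCast_smul_single (n : ℕ) :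
    cylRadius ((n : ℝ) • (EuclideanSpace.single 0 1 : EuclideanSpace ℝ (Fin 3))) = n := by
  rw [cylRadius_smul, cylRadius_single_zero, abs_one, mul_one, Nat.abs_cast]

/-- **Horizontal translates of a horizontally decaying field tend to zero**: if
`cylRadius (y − c)‖g(y)‖ ≤ D` then `g(y + c + n e₁) → 0` as `n → ∞`, for every `y`
(since `cylRadius (y + n e₁) ≥ n − ‖y‖`). [folklore] -/
theorem tendsto_translate_axis_of_cylRadius_decay {g : EuclideanSpace ℝ (Fin 3) → F}
    {c : EuclideanSpace ℝ (Fin 3)} {D : ℝ} (hD : ∀ y, cylRadius (y - c) * ‖g y‖ ≤ D)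
    (y : EuclideanSpace ℝ (Fin 3)) :
    Tendsto (fun n : ℕ => g (y + (c + (n : ℝ) • (EuclideanSpace.single 0 1 : EuclideanSpace ℝ (Fin 3)))))
      atTop (𝓝 0) := by
  set e₁ : EuclideanSpace ℝ (Fin 3) := EuclideanSpace.single 0 1 with he₁
  have hD0 : 0 ≤ D := (mul_nonneg (cylRadius_nonneg _) (norm_nonneg _)).trans (hD c)
  -- the cylindrical radius of the translated point
  have hrad : ∀ n : ℕ, (n : ℝ) - ‖y‖ ≤ cylRadius (y + (c + (n : ℝ) • e₁) - c) := by
    intro n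
    have h := cylRadius_le_cylRadius_add_norm_sub (y + (n : ℝ) • e₁) ((n : ℝ) • e₁)
    rw [cylRadius_natCast_smul_single, show (n : ℝ) • e₁ - (y + (n : ℝ) • e₁) = -y by abel, norm_neg] at h
    rw [show y + (c + (n : ℝ) • e₁) - c = y + (n : ℝ) • e₁ by abel]
    linarith
  refine squeeze_zero_norm' ?_ ((tendsto_const_nhds (x := D)).div_atTop
    (tendsto_atTop_add_const_right _ (-‖y‖) tendsto_natCast_atTop_atTop))
  filter_upwards [eventually_gt_atTop (⌈‖y‖⌉₊ : ℕ)] with n hn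
  have hn' : ‖y‖ < n := (Nat.le_ceil _).trans_lt (by exact_mod_cast hn)
  have hpos : 0 < (n : ℝ) - ‖y‖ := sub_pos.2 hn'
  have hradpos : 0 < cylRadius (y + (c + (n : ℝ) • e₁) - c) := hpos.trans_le (hrad n)
  rw [show (n : ℝ) + -‖y‖ = (n : ℝ) - ‖y‖ by ring, le_div_iff₀ hpos]
  calc ‖g (y + (c + (n : ℝ) • e₁))‖ * ((n : ℝ) - ‖y‖)
      ≤ ‖g (y + (c + (n : ℝ) • e₁))‖ * cylRadius (y + (c + (n : ℝ) • e₁) - c) :=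
        mul_le_mul_of_nonneg_left (hrad n) (norm_nonneg _)
    _ = cylRadius (y + (c + (n : ℝ) • e₁) - c) * ‖g (y + (c + (n : ℝ) • e₁))‖ := mul_comm _ _
    _ ≤ D := hD _

end Decay

/-! ### The mildness clause on a window `(0, T)` -/

section Window

variable {F : Type*} [NormedAddCommGroup F] [NormedSpace ℝ F]

/-- Local copy of the translation covariance of the caloric extension
(`heatExtension_comp_add_right` of `KatoSymmetryCovariance.lean`, not imported here):
`e^{σΔ}(g(· + a))(x) = e^{σΔ}g(x + a)`. [folklore] -/
private theorem heatExtension_comp_add_right_aux (g : EuclideanSpace ℝ (Fin 3) → F)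
    (a : EuclideanSpace ℝ (Fin 3)) (σ : ℝ) (x : EuclideanSpace ℝ (Fin 3)) :
    UnboundedOperators.heatExtension (fun y => g (y + a)) σ x =
      UnboundedOperators.heatExtension g σ (x + a) := by
  simp only [UnboundedOperators.heatExtension_apply]
  refine integral_congr_ae (Eventually.of_forall fun y => ?_)
  simp only [sub_add_eq_add_sub]

/-- The caloric extension of the zero field vanishes. [folklore] -/
theorem heatExtension_zero_fun (σ : ℝ) (x : EuclideanSpace ℝ (Fin 3)) :
    UnboundedOperators.heatExtension (fun _ : EuclideanSpace ℝ (Fin 3) => (0 : F)) σ x = 0 := by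
  simp [UnboundedOperators.heatExtension_apply]

/-- **KNSS 2009, Theorem 6.1, mildness clause, on a window `(0, T)`, from Lemma 3.1 — BOUNDED
WEAK form** (the printed statement is about bounded weak solutions): a field `u` on `ℝ³ × (0, T)`
which is jointly continuous on the open slab, a bounded weak solution of the unforced Navier–Stokes
system (`ν = 1`), bounded by `L` and with `cylRadius (x − c)‖u(t, x)‖ ≤ D`, satisfies
`u(t, x) = e^{(t−s)Δ}u(s)(x) − B¹_s(u,u)(t)(x)` for all `0 < s < t < T` and all `x`, granted
KNSS's Lemma 3.1 in drift-mild form (`KNSS2009_weak_driftMild`). Steps 1–5 of the module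
docstring (they use the solution only through its continuity on the open slab and its bounded weak
form). [cite: KochNadirashviliSereginSverak2009, Thm 6.1 (mildness clause) and its proof, last paragraph (arXiv pp. 11–12)] -/
theorem oseenMild_of_cylRadius_decay_window_of_boundedWeak (h31 : KNSS2009_weak_driftMild) {T : ℝ}
    {u : ℝ → EuclideanSpace ℝ (Fin 3) → EuclideanSpace ℝ (Fin 3)}
    (hcont : ContinuousOn (uncurry u) (Ioo 0 T ×ˢ univ))
    (hbw : IsBoundedWeakNSSolutionOn (Ioo 0 T) isOpen_Ioo 1 u) {L : ℝ} (hL : ∀ t ∈ Ioo 0 T, ∀ x, ‖u t x‖ ≤ L)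
    {c : EuclideanSpace ℝ (Fin 3)} {D : ℝ} (hD : ∀ t ∈ Ioo 0 T, ∀ x, cylRadius (x - c) * ‖u t x‖ ≤ D) :
    ∀ s t : ℝ, 0 < s → s < t → t < T → ∀ x,
      u t x = UnboundedOperators.heatExtension (u s) (t - s) x - oseenDuhamel 1 s u u t x := by
  intro s t hs hst htT
  have hT : 0 < T := hs.trans (hst.trans htT)
  -- ## basic facts about the solution
  have hslice : ∀ τ ∈ Ioo 0 T, Continuous (u τ) := fun τ hτ =>
    hcont.comp_continuous (Continuous.prodMk_right τ) fun x => ⟨hτ, mem_univ x⟩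
  have hL0 : 0 ≤ L := (norm_nonneg _).trans (hL s ⟨hs, hst.trans htT⟩ 0)
  -- measurability of (translates of) `u` on sub-slabs
  have hmeas_tr : ∀ (x' : EuclideanSpace ℝ (Fin 3)) (a b : ℝ), 0 ≤ a → b ≤ T →
      AEStronglyMeasurable (uncurry fun σ y => u σ (y + x'))
        ((volume : Measure (ℝ × EuclideanSpace ℝ (Fin 3))).restrict (Ioo a b ×ˢ univ)) := by
    intro x' a b ha hb
    have hc : ContinuousOn (uncurry fun σ y => u σ (y + x')) (Ioo a b ×ˢ univ) := by
      refine (hcont.comp (continuous_fst.prodMk (continuous_snd.add continuous_const)).continuousOn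
        fun q hq => ⟨⟨ha.trans_lt hq.1.1, hq.1.2.trans_le hb⟩, mem_univ _⟩)
    exact hc.aestronglyMeasurable (measurableSet_Ioo.prod MeasurableSet.univ)
  have hmeas : ∀ a b : ℝ, 0 ≤ a → b ≤ T →
      AEStronglyMeasurable (uncurry u) ((volume : Measure (ℝ × EuclideanSpace ℝ (Fin 3))).restrict (Ioo a b ×ˢ univ)) := by
    intro a b ha hb
    simpa using hmeas_tr 0 a b ha hb
  -- continuity of the two terms of the right-hand side in `x`
  have hRHSc : ∀ s₀ ∈ Ioo 0 T, ∀ τ, s₀ < τ → τ < T →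
      Continuous fun y => UnboundedOperators.heatExtension (u s₀) (τ - s₀) y - oseenDuhamel 1 s₀ u u τ y := by
    intro s₀ hs₀ τ hlt hτT
    refine (UnboundedOperators.contDiff_heatExtension_of_bound (hslice s₀ hs₀) (hL s₀ hs₀)
      (sub_pos.2 hlt) (m := 0)).continuous.sub ?_
    exact continuous_oseenDuhamel_slice one_pos hL0 (hmeas s₀ T hs₀.1.le le_rfl) (hmeas s₀ T hs₀.1.le le_rfl)
      (fun σ hσ y => hL σ ⟨hs₀.1.trans hσ.1, hσ.2⟩ y) (fun σ hσ y => hL σ ⟨hs₀.1.trans hσ.1, hσ.2⟩ y)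
      hlt hτT.le
  -- ## Step 1: Lemma 3.1
  obtain ⟨N, hN⟩ := h31 L T hT
  obtain ⟨U, bd, hUb, hae⟩ := hN hbw hL
  set Gd : Set ℝ := {τ | τ ∈ Ioo 0 T → u τ =ᵐ[volume] fun y => U τ y + bd τ} with hGd
  have hgood : ∀ᵐ τ ∂(volume : Measure ℝ), τ ∈ Gd := by
    have h1 := (ae_restrict_iff' (measurableSet_Ioo (a := (0 : ℝ)) (b := T))).1 hae
    filter_upwards [h1] with τ hτ hτ'
    exact hτ hτ'
  have hdense : Dense Gd := Measure.dense_of_ae hgood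
  have hE : Module.finrank ℝ (EuclideanSpace ℝ (Fin 3)) = 3 := finrank_euclideanSpace_fin
  -- ## Step 2: the drift-mild identity read on `u`
  have hstar : ∀ s₀ ∈ Ioo 0 T, s₀ ∈ Gd → ∀ τ, s₀ < τ → τ < T → ∀ y,
      U τ y = UnboundedOperators.heatExtension (u s₀) (τ - s₀) y - bd s₀ - oseenDuhamel 1 s₀ u u τ y := by
    intro s₀ hs₀ hs₀G τ hlt hτT y
    have hmildU := hUb.mild s₀ τ hs₀.1 hlt hτT y
    -- the caloric part
    have hUs : U s₀ =ᵐ[volume] fun z => u s₀ z - bd s₀ := by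
      filter_upwards [hs₀G hs₀] with z hz
      rw [hz, add_sub_cancel_right]
    have hheat : UnboundedOperators.heatExtension (U s₀) (τ - s₀) y =
        UnboundedOperators.heatExtension (u s₀) (τ - s₀) y - bd s₀ := by
      rw [UnboundedOperators.heatExtension_congr_ae' hUs,
        UnboundedOperators.heatExtension_sub_of_bound (hslice s₀ hs₀) continuous_const (hL s₀ hs₀)
          (fun _ => le_rfl) (sub_pos.2 hlt) y, UnboundedOperators.heatExtension_const _ (sub_pos.2 hlt)]
    -- the Duhamel part
    have hdrift : driftDuhamel U bd s₀ τ y = oseenDuhamel 1 s₀ u u τ y := by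
      have h1 : driftDuhamel U bd s₀ τ y = driftDuhamel u 0 s₀ τ y := by
        refine driftDuhamel_congr_ae hlt.le ?_ y
        have h2 : ∀ᵐ σ ∂((volume : Measure ℝ).restrict (Ioo s₀ τ)), u σ =ᵐ[volume] fun z => U σ z + bd σ :=
          ae_restrict_of_ae_restrict_of_subset (Ioo_subset_Ioo hs₀.1.le hτT.le) hae
        filter_upwards [h2] with σ hσ
        filter_upwards [hσ] with z hz
        simp only [Pi.zero_apply, add_zero]
        exact hz.symm
      rw [h1]
      exact driftDuhamel_zero_eq_oseenDuhamel hE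
        (fun σ hσ => (hslice σ ⟨hs₀.1.trans hσ.1, hσ.2.trans hτT⟩).measurable)
        (fun σ hσ z => hL σ ⟨hs₀.1.trans hσ.1, hσ.2.trans hτT⟩ z) hlt.le y
    rw [hmildU, hheat, hdrift]
  -- ## Step 3: the decay kills the drift
  set e₁ : EuclideanSpace ℝ (Fin 3) := EuclideanSpace.single 0 1 with he₁
  set xs : ℕ → EuclideanSpace ℝ (Fin 3) := fun n => c + (n : ℝ) • e₁ with hxs
  have hconst : ∀ s₀ ∈ Ioo 0 T, s₀ ∈ Gd → ∀ τ ∈ Ioo 0 T, τ ∈ Gd → s₀ < τ → bd τ = bd s₀ := by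
    intro s₀ hs₀ hs₀G τ hτ hτG hlt
    set Φ : EuclideanSpace ℝ (Fin 3) → EuclideanSpace ℝ (Fin 3) := fun y =>
      u τ y - UnboundedOperators.heatExtension (u s₀) (τ - s₀) y + oseenDuhamel 1 s₀ u u τ y with hΦ
    have hΦc : Continuous Φ := by
      have h := hRHSc s₀ hs₀ τ hlt hτ.2
      have : Φ = fun y => u τ y - (UnboundedOperators.heatExtension (u s₀) (τ - s₀) y - oseenDuhamel 1 s₀ u u τ y) := by
        funext y; simp only [hΦ]; abel
      rw [this]
      exact (hslice τ hτ).sub h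
    have hae' : (fun _ => bd τ - bd s₀) =ᵐ[volume] Φ := by
      filter_upwards [hτG hτ] with y hy
      simp only [hΦ]
      rw [hy, hstar s₀ hs₀ hs₀G τ hlt hτ.2 y]
      abel
    have heq : (fun _ => bd τ - bd s₀) = Φ := (Continuous.ae_eq_iff_eq volume continuous_const hΦc).1 hae'
    have hΦn : ∀ n, Φ (xs n) = bd τ - bd s₀ := fun n => (congrFun heq (xs n)).symm
    -- the three limits along the axis points
    have hlim1 : Tendsto (fun n => u τ (xs n)) atTop (𝓝 0) := by
      have h := tendsto_translate_axis_of_cylRadius_decay (hD τ hτ) 0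
      simpa only [zero_add] using h
    have hlim2 : Tendsto (fun n => UnboundedOperators.heatExtension (u s₀) (τ - s₀) (xs n)) atTop (𝓝 0) := by
      have h := tendsto_heatExtension_of_tendsto_of_bound (f := fun n y => u s₀ (y + xs n))
        (g := fun _ => (0 : EuclideanSpace ℝ (Fin 3)))
        (fun n => ((hslice s₀ hs₀).comp (continuous_id.add continuous_const)).aestronglyMeasurable)
        (fun n z => hL s₀ hs₀ _) (fun z => tendsto_translate_axis_of_cylRadius_decay (hD s₀ hs₀) z)
        (sub_pos.2 hlt) 0
      simp only [heatExtension_comp_add_right_aux, zero_add, heatExtension_zero_fun] at h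
      exact h
    have hlim3 : Tendsto (fun n => oseenDuhamel 1 s₀ u u τ (xs n)) atTop (𝓝 0) := by
      have h0m : AEStronglyMeasurable (uncurry (0 : ℝ → EuclideanSpace ℝ (Fin 3) → EuclideanSpace ℝ (Fin 3)))
          ((volume : Measure (ℝ × EuclideanSpace ℝ (Fin 3))).restrict (Ioo s₀ τ ×ˢ univ)) :=
        aestronglyMeasurable_const
      have h := tendsto_oseenDuhamel_of_tendsto_of_bound one_pos hL0 hlt
        (u := fun n σ y => u σ (y + xs n)) (u₀ := 0)
        (fun n => hmeas_tr (xs n) s₀ τ hs₀.1.le hτ.2.le) h0m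
        (fun n σ hσ y => hL σ ⟨hs₀.1.trans hσ.1, hσ.2.trans hτ.2⟩ _)
        (fun σ hσ y => by
          simpa only [Pi.zero_apply] using
            tendsto_translate_axis_of_cylRadius_decay (hD σ ⟨hs₀.1.trans hσ.1, hσ.2.trans hτ.2⟩) y) 0
      simp only [oseenDuhamel_comp_add_right, zero_add, oseenDuhamel_zero_left, Pi.zero_apply] at h
      exact h
    have hlimΦ : Tendsto (fun n => Φ (xs n)) atTop (𝓝 (0 - 0 + 0)) := (hlim1.sub hlim2).add hlim3
    rw [sub_zero, add_zero] at hlimΦ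
    have h0 : bd τ - bd s₀ = 0 :=
      tendsto_nhds_unique (tendsto_const_nhds.congr fun n => (hΦn n).symm) hlimΦ
    exact sub_eq_zero.1 h0
  -- ## the identity between good times, everywhere in `x`
  have hgoodpair : ∀ s₀ ∈ Ioo 0 T, s₀ ∈ Gd → ∀ τ ∈ Ioo 0 T, τ ∈ Gd → s₀ < τ → ∀ y,
      u τ y = UnboundedOperators.heatExtension (u s₀) (τ - s₀) y - oseenDuhamel 1 s₀ u u τ y := by
    intro s₀ hs₀ hs₀G τ hτ hτG hlt
    have hb := hconst s₀ hs₀ hs₀G τ hτ hτG hlt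
    have h1 : u τ =ᵐ[volume] fun y =>
        UnboundedOperators.heatExtension (u s₀) (τ - s₀) y - oseenDuhamel 1 s₀ u u τ y := by
      filter_upwards [hτG hτ] with y hy
      rw [hy, hstar s₀ hs₀ hs₀G τ hlt hτ.2 y, hb]
      abel
    exact congrFun ((Continuous.ae_eq_iff_eq volume (hslice τ hτ) (hRHSc s₀ hs₀ τ hlt hτ.2)).1 h1)
  -- ## Step 4: from a good time to every later time
  have hgoodall : ∀ s₀ ∈ Ioo 0 T, s₀ ∈ Gd → ∀ τ, s₀ < τ → τ < T → ∀ y,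
      u τ y = UnboundedOperators.heatExtension (u s₀) (τ - s₀) y - oseenDuhamel 1 s₀ u u τ y := by
    intro s₀ hs₀ hs₀G τ hlt hτT y
    have hsub := hdense.open_subset_closure_inter (isOpen_Ioo (a := s₀) (b := T))
    obtain ⟨tq, htq, htql⟩ := mem_closure_iff_seq_limit.1 (hsub ⟨hlt, hτT⟩)
    have hn : ∀ n, u (tq n) y =
        UnboundedOperators.heatExtension (u s₀) (tq n - s₀) y - oseenDuhamel 1 s₀ u u (tq n) y := fun n =>
      hgoodpair s₀ hs₀ hs₀G (tq n) ⟨hs₀.1.trans (htq n).1.1, (htq n).1.2⟩ (htq n).2 (htq n).1.1 y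
    -- the left-hand side
    have hLHS : Tendsto (fun n => u (tq n) y) atTop (𝓝 (u τ y)) := by
      have h1 : ContinuousAt (uncurry u) (τ, y) :=
        hcont.continuousAt ((isOpen_Ioo.prod isOpen_univ).mem_nhds ⟨⟨hs₀.1.trans hlt, hτT⟩, mem_univ y⟩)
      exact h1.tendsto.comp (htql.prodMk_nhds tendsto_const_nhds)
    -- the caloric term
    have hH : Tendsto (fun n => UnboundedOperators.heatExtension (u s₀) (tq n - s₀) y) atTop
        (𝓝 (UnboundedOperators.heatExtension (u s₀) (τ - s₀) y)) := by
      have hmem : MemLp (u s₀) ∞ (volume : Measure (EuclideanSpace ℝ (Fin 3))) :=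
        memLp_top_of_bound (hslice s₀ hs₀).aestronglyMeasurable L (Eventually.of_forall (hL s₀ hs₀))
      have hc := UnboundedOperators.continuousOn_heatExtension_time hmem le_top y
      have hca : ContinuousAt (fun σ : ℝ => UnboundedOperators.heatExtension (u s₀) σ y) (τ - s₀) :=
        hc.continuousAt (Ioi_mem_nhds (sub_pos.2 hlt))
      exact hca.tendsto.comp (htql.sub_const s₀)
    -- the Duhamel term
    have hDu : Tendsto (fun n => oseenDuhamel 1 s₀ u u (tq n) y) atTop (𝓝 (oseenDuhamel 1 s₀ u u τ y)) := by
      have hc := continuousOn_oseenDuhamel_time one_pos (hmeas s₀ T hs₀.1.le le_rfl) hL0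
        (fun σ hσ z => hL σ ⟨hs₀.1.trans hσ.1, hσ.2⟩ z) y
      have hcw : ContinuousWithinAt (fun t => oseenDuhamel 1 s₀ u u t y) (Icc s₀ T) τ := hc τ ⟨hlt.le, hτT.le⟩
      refine hcw.tendsto.comp (tendsto_nhdsWithin_iff.2 ⟨htql, Eventually.of_forall fun n => ?_⟩)
      exact ⟨(htq n).1.1.le, (htq n).1.2.le⟩
    have hRHS : Tendsto (fun n => u (tq n) y) atTop
        (𝓝 (UnboundedOperators.heatExtension (u s₀) (τ - s₀) y - oseenDuhamel 1 s₀ u u τ y)) := by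
      have h := hH.sub hDu
      exact h.congr fun n => (hn n).symm
    exact tendsto_nhds_unique hLHS hRHS
  -- ## Step 5: arbitrary pairs of times by the restart property
  obtain ⟨s₀, hs₀G, hs₀I⟩ := hdense.exists_mem_open isOpen_Ioo (nonempty_Ioo.2 hs)
  have hs₀ : s₀ ∈ Ioo 0 T := ⟨hs₀I.1, hs₀I.2.trans (hst.trans htT)⟩
  have hbound : ∀ σ ∈ Ioo s₀ T, eLpNorm (u σ) ∞ volume ≤ ENNReal.ofReal L := fun σ hσ => by
    rw [eLpNorm_exponent_top]
    exact eLpNormEssSup_le_of_ae_bound (Eventually.of_forall (hL σ ⟨hs₀.1.trans hσ.1, hσ.2⟩))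
  have hbound₀ : eLpNorm (u s₀) ∞ volume ≤ ENNReal.ofReal L := by
    rw [eLpNorm_exponent_top]
    exact eLpNormEssSup_le_of_ae_bound (Eventually.of_forall (hL s₀ hs₀))
  have husol : ∀ σ ∈ Ioo s₀ T, u σ =ᵐ[volume] fun y =>
      UnboundedOperators.heatExtension (u s₀) (1 * (σ - s₀)) y - oseenDuhamel 1 s₀ u u σ y := fun σ hσ =>
    Eventually.of_forall fun y => by rw [one_mul]; exact hgoodall s₀ hs₀ hs₀G σ hσ.1 hσ.2 y
  have hR := restart_of_oseenMild_restart (oseenMild_restart_holds (EuclideanSpace ℝ (Fin 3))) one_pos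
    hs₀.2 (hslice s₀ hs₀).aestronglyMeasurable hbound₀ (hmeas s₀ T hs₀.1.le le_rfl) hbound husol
    hs₀I.2 hst htT
  have h1 : u t =ᵐ[volume] fun y => UnboundedOperators.heatExtension (u s) (t - s) y - oseenDuhamel 1 s u u t y := by
    simpa only [one_mul] using hR
  have hsI : s ∈ Ioo 0 T := ⟨hs, hst.trans htT⟩
  exact congrFun ((Continuous.ae_eq_iff_eq volume (hslice t ⟨hs.trans hst, htT⟩) (hRHSc s hsI t hst htT)).1 h1)

/-- **KNSS 2009, Theorem 6.1, mildness clause, on a window `(0, T)`, from Lemma 3.1**: a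
classical solution `(u, p)` of the unforced Navier–Stokes system (`ν = 1`) on `ℝ³ × (0, T)`,
bounded by `L` and with `cylRadius (x − c)‖u(t, x)‖ ≤ D`, satisfies
`u(t, x) = e^{(t−s)Δ}u(s)(x) − B¹_s(u,u)(t)(x)` for all `0 < s < t < T` and all `x`, granted
KNSS's Lemma 3.1 in drift-mild form (`KNSS2009_weak_driftMild`). Corollary of the bounded weak
form `oseenMild_of_cylRadius_decay_window_of_boundedWeak` (a bounded classical solution is
continuous on the open slab and a bounded weak solution). [cite: KochNadirashviliSereginSverak2009, Thm 6.1 (mildness clause) and its proof, last paragraph (arXiv pp. 11–12)] -/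
theorem oseenMild_of_cylRadius_decay_window (h31 : KNSS2009_weak_driftMild) {T : ℝ}
    {u : ℝ → EuclideanSpace ℝ (Fin 3) → EuclideanSpace ℝ (Fin 3)} {p : ℝ → EuclideanSpace ℝ (Fin 3) → ℝ}
    (hcl : IsClassicalNSSolutionOn (Ioo 0 T) 1 0 u p) {L : ℝ} (hL : ∀ t ∈ Ioo 0 T, ∀ x, ‖u t x‖ ≤ L)
    {c : EuclideanSpace ℝ (Fin 3)} {D : ℝ} (hD : ∀ t ∈ Ioo 0 T, ∀ x, cylRadius (x - c) * ‖u t x‖ ≤ D) :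
    ∀ s t : ℝ, 0 < s → s < t → t < T → ∀ x,
      u t x = UnboundedOperators.heatExtension (u s) (t - s) x - oseenDuhamel 1 s u u t x :=
  oseenMild_of_cylRadius_decay_window_of_boundedWeak h31 hcl.smooth_velocity.continuousOn
    (hcl.isBoundedWeakNSSolutionOn ⟨L, hL⟩) hL hD

end Window

/-! ### The mildness clause on an arbitrary window -/

section General

/-- **KNSS 2009, Theorem 6.1, mildness clause, from Lemma 3.1**: granted KNSS's Lemma 3.1 in
drift-mild form (`KNSS2009_weak_driftMild`), every classical solution `(u, p)` of the unforced
Navier–Stokes system (`ν = 1`) on `ℝ³ × (a, b)` which is bounded on the window and satisfies the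
horizontal decay `cylRadius (x − c)‖u(t, x)‖ ≤ D` obeys the Oseen integral equation
`u(t, x) = e^{(t−s)Δ}u(s)(x) − B¹_s(u,u)(t)(x)` for all `a < s < t < b` and all `x` — the statement
of the named fact `KNSS2009_oseenMild_of_cylRadius_decay` (`KNSSOseenMildDecay.lean`), written
out (time translation of `oseenMild_of_cylRadius_decay_window`). [cite: KochNadirashviliSereginSverak2009, Thm 6.1 (mildness clause) and its proof, last paragraph (arXiv pp. 11–12), with Lemma 3.1 (p. 7)] -/
theorem KNSS2009_oseenMild_of_cylRadius_decay_of_weak_driftMild (h31 : KNSS2009_weak_driftMild) :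
    ∀ ⦃a b : ℝ⦄ ⦃u : ℝ → EuclideanSpace ℝ (Fin 3) → EuclideanSpace ℝ (Fin 3)⦄
      ⦃p : ℝ → EuclideanSpace ℝ (Fin 3) → ℝ⦄,
      IsClassicalNSSolutionOn (Ioo a b) 1 0 u p →
      (∃ L : ℝ, ∀ t ∈ Ioo a b, ∀ x, ‖u t x‖ ≤ L) →
      (∃ (c : EuclideanSpace ℝ (Fin 3)) (D : ℝ), ∀ t ∈ Ioo a b, ∀ x, cylRadius (x - c) * ‖u t x‖ ≤ D) →
      ∀ s t : ℝ, a < s → s < t → t < b → ∀ x,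
        u t x = UnboundedOperators.heatExtension (u s) (t - s) x - oseenDuhamel 1 s u u t x := by
  rintro a b u p hcl ⟨L, hL⟩ ⟨c, D, hD⟩ s t has hst htb x
  -- translate the window to `(0, b - a)`
  have hclv : IsClassicalNSSolutionOn (Ioo 0 (b - a)) 1 0 (fun τ => u (τ + a)) (fun τ => p (τ + a)) := by
    have h := hcl.comp_add_right a
    rw [preimage_add_const_Ioo, sub_self] at h
    exact h
  have hLv : ∀ τ ∈ Ioo 0 (b - a), ∀ y, ‖u (τ + a) y‖ ≤ L := fun τ hτ y =>
    hL (τ + a) ⟨by linarith [hτ.1], by linarith [hτ.2]⟩ y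
  have hDv : ∀ τ ∈ Ioo 0 (b - a), ∀ y, cylRadius (y - c) * ‖u (τ + a) y‖ ≤ D := fun τ hτ y =>
    hD (τ + a) ⟨by linarith [hτ.1], by linarith [hτ.2]⟩ y
  have hw := oseenMild_of_cylRadius_decay_window h31 hclv hLv hDv (s - a) (t - a)
    (by linarith) (by linarith) (by linarith) x
  rw [oseenDuhamel_translate 1 (s - a) a u u (t - a) x] at hw
  simp only [sub_add_cancel] at hw
  rw [show t - a - (s - a) = t - s by ring] at hw
  exact hw

end General

end Literature.Analysis.FluidPDE

end
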